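import Summits.NavierStokesRegularity.NavierStokesRegularity.Theorems.HodographBetchovFastClassSqueezeGerm
import Summits.NavierStokesRegularity.NavierStokesRegularity.Theorems.HodographBetchovFastClassSqueezeMiddleStrainWeyl

/-!
# `FastClassSqueeze` (stmt-NavierStokesRegularity-15832): cover glue over the compact top singular set

Line `Sketch-ideasK1` (idea `resolved-weyl-split`) of crux 3 of route `HodographBetchov`, registered stub
`stub_germ_of_pointSqueeze`.  For a flow of the crux on `ℝ³ × [0,T)` (classical, Leray–Hopf from a rapidly
decaying datum) and an exponent `q > 3/2`: if every backward-singular point `(T, x₀)` carries a germ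
`(τ,T) × B_r(x₀)` (`0 ≤ τ < T`) and a level `l` on which the Miller functional
`∫_τ^T (∫_{{l<|u(t)|} ∩ B_r(x₀)} (λ₂(∇u)⁺)^q dx)^{2/(2q−3)} dt` of the middle principal strain
`λ₂(A) = strainEigenvalues A _ 1` of the fast fluid is finite (the tree's
`Literature.Analysis.FluidPDE.strainEigenvalues`, clipped at `0` by `ENNReal.ofReal`; no new definition),
then the germ data of `Germ.fastClassSqueeze_of_germSqueeze` exist: an open `U ⊇ Σ_T(u)`, a time `τ < T`,
a level `l` and the nonnegative min–max majorant `m = λ₂⁺` on the fast points of `(τ,T) × U` with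
`∫_τ^T (∫_{{l<|u(t)|} ∩ U} m^q)^{2/(2q−3)} < ∞`.

Proof.  `Σ_T(u)` is compact (`Germ.isCompact_topSingularSet`), so finitely many germ balls cover it; `U` is
their union, `τ` the latest germ time, `l` the highest germ level.  Pointwise in time the fast slice of `U`
lies in the union of the germ slices; a lower integral over a finite union is at most `card · max`
(`lintegral_biUnion_finset_le_card_mul`), whence `(∫_{⋃})^e ≤ card^e · Σ (∫_{germ})^e` for `e ≥ 0`
(`rpow_lintegral_biUnion_finset_le`).  In time the finite sum is pulled out of the lower integral along the
measurable-in-time versions of the germ slices (`GermWeyl.exists_measurable_middleStrain_slice`, valid on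
`(0,T) ⊇ (τ,T)` — this is where `0 ≤ τ` is used), and each summand is at most its germ functional.  The
min–max clause for `m = λ₂⁺` is Courant–Fischer (`middleStrain_le_iff`, Horn–Johnson Thm. 4.2.6).
-/

noncomputable section

-- the summit and its single problem share the name `NavierStokesRegularity` (D-0017 nested layout)
set_option linter.dupNamespace false

namespace Summit.NavierStokesRegularity.NavierStokesRegularity.Theorems.FastClassSqueeze.GermWeyl

open Set MeasureTheory Filter Topology Metric Literature.Analysis.FluidPDE
open scoped ENNReal NNReal

/-- **Powers of lower integrals over a finite union.** For a nonempty finset `F`, sets `S y`, an integrand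
`g` and an exponent `e ≥ 0`: `(∫_{⋃_{y∈F} S y} g)^e ≤ (card F)^e · Σ_{y∈F} (∫_{S y} g)^e` (the integral over
the union is at most `card F` times the largest piece, `lintegral_biUnion_finset_le_card_mul`, and a single
term is at most the sum). [folklore] -/
theorem rpow_lintegral_biUnion_finset_le {α ι : Type*} [MeasurableSpace α] (μ : Measure α)
    {F : Finset ι} (hF : F.Nonempty) (S : ι → Set α) (g : α → ℝ≥0∞) {e : ℝ} (he : 0 ≤ e) :
    (∫⁻ x in ⋃ y ∈ F, S y, g x ∂μ) ^ e ≤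
      (F.card : ℝ≥0∞) ^ e * ∑ y ∈ F, (∫⁻ x in S y, g x ∂μ) ^ e := by
  obtain ⟨y₀, hy₀, hmax⟩ := F.exists_max_image (fun y => ∫⁻ x in S y, g x ∂μ) hF
  calc (∫⁻ x in ⋃ y ∈ F, S y, g x ∂μ) ^ e
      ≤ ((F.card : ℝ≥0∞) * ∫⁻ x in S y₀, g x ∂μ) ^ e :=
        ENNReal.rpow_le_rpow (lintegral_biUnion_finset_le_card_mul F S g hmax) he
    _ = (F.card : ℝ≥0∞) ^ e * (∫⁻ x in S y₀, g x ∂μ) ^ e := ENNReal.mul_rpow_of_nonneg _ _ he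
    _ ≤ (F.card : ℝ≥0∞) ^ e * ∑ y ∈ F, (∫⁻ x in S y, g x ∂μ) ^ e :=
        mul_le_mul_right
          (Finset.single_le_sum_of_canonicallyOrdered (f := fun y => (∫⁻ x in S y, g x ∂μ) ^ e) hy₀) _

/-- **Stub 3 of line `Sketch-ideasK1` — cover glue over the compact top singular set.** For a flow of the
crux and an exponent `q > 3/2`: if at every backward-singular point `(T, x₀)` some germ `(τ,T) × B_r(x₀)`
(`0 ≤ τ < T`) and level `l` carry a finite Miller functional of the middle principal strain `λ₂(∇u)⁺` of the
fast fluid, then there are an open `U ⊇ Σ_T(u)`, a time `τ < T`, a level `l` and a nonnegative min–max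
majorant `m` on the fast points of `(τ,T) × U` with `∫_τ^T (∫_{{l<|u(t)|} ∩ U} m^q)^{2/(2q−3)} < ∞` — the
hypothesis of `Germ.fastClassSqueeze_of_germSqueeze` (finite subcover of the compact `Σ_T(u)`,
`m = λ₂(∇u)⁺`, Courant–Fischer for the min–max clause). [cite: HornJohnson2013, Thm 4.2.6] -/
theorem stub_germ_of_pointSqueeze :
    ∀ (ν T : ℝ), 0 < ν → 0 < T →
      ∀ (u : ℝ → EuclideanSpace ℝ (Fin 3) → EuclideanSpace ℝ (Fin 3)) (p : ℝ → EuclideanSpace ℝ (Fin 3) → ℝ),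
      Literature.Analysis.FluidPDE.IsClassicalNSSolutionOn (Set.Ico 0 T) ν 0 u p →
      Literature.Analysis.FluidPDE.IsLerayHopfOn T ν 0 (u 0) u →
      Literature.Analysis.FluidPDE.HasRapidSpatialDecay (u 0) →
      ∀ q : ℝ, 3 / 2 < q →
        (∀ x₀ : EuclideanSpace ℝ (Fin 3), Literature.Analysis.FluidPDE.IsBackwardSingularPoint u (T, x₀) →
          ∃ r : ℝ, 0 < r ∧ ∃ τ : ℝ, 0 ≤ τ ∧ τ < T ∧ ∃ l : ℝ,
            ∫⁻ t in Set.Ioo τ T, (∫⁻ x in {x : EuclideanSpace ℝ (Fin 3) | l < ‖u t x‖} ∩ Metric.ball x₀ r,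
              ENNReal.ofReal (Literature.Analysis.FluidPDE.strainEigenvalues
                ((fderiv ℝ (u t) x : EuclideanSpace ℝ (Fin 3) →L[ℝ] EuclideanSpace ℝ (Fin 3)) :
                  EuclideanSpace ℝ (Fin 3) →ₗ[ℝ] EuclideanSpace ℝ (Fin 3))
                finrank_euclideanSpace_fin 1) ^ q) ^ (2 / (2 * q - 3)) < ⊤) →
        ∃ U : Set (EuclideanSpace ℝ (Fin 3)), IsOpen U ∧
          {x : EuclideanSpace ℝ (Fin 3) | Literature.Analysis.FluidPDE.IsBackwardSingularPoint u (T, x)} ⊆ U ∧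
          ∃ τ : ℝ, τ < T ∧ ∃ l : ℝ, ∃ m : ℝ → EuclideanSpace ℝ (Fin 3) → ℝ,
            (∀ t x, 0 ≤ m t x) ∧
            (∀ t ∈ Set.Ico 0 T, τ < t → ∀ x ∈ U, l < ‖u t x‖ →
              ∃ v w : EuclideanSpace ℝ (Fin 3), ‖v‖ = 1 ∧ ‖w‖ = 1 ∧ inner ℝ v w = 0 ∧
                ∀ α β : ℝ, inner ℝ (fderiv ℝ (u t) x (α • v + β • w)) (α • v + β • w) ≤
                  m t x * (α ^ 2 + β ^ 2)) ∧
            ∫⁻ t in Set.Ioo τ T, (∫⁻ x in {x : EuclideanSpace ℝ (Fin 3) | l < ‖u t x‖} ∩ U,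
              ENNReal.ofReal (m t x) ^ q) ^ (2 / (2 * q - 3)) < ⊤ := by
  intro ν T hν hT u p hcl hLH hdec q hq hpt
  have he : 0 < 2 / (2 * q - 3) := div_pos two_pos (by linarith)
  -- the majorant `m = λ₂⁺`: nonnegative, min–max clause by Courant–Fischer, and `ofReal m = ofReal λ₂`
  obtain ⟨m, hm⟩ : ∃ m : ℝ → EuclideanSpace ℝ (Fin 3) → ℝ, ∀ t x, m t x = max (strainEigenvalues
      ((fderiv ℝ (u t) x : EuclideanSpace ℝ (Fin 3) →L[ℝ] EuclideanSpace ℝ (Fin 3)) :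
        EuclideanSpace ℝ (Fin 3) →ₗ[ℝ] EuclideanSpace ℝ (Fin 3)) finrank_euclideanSpace_fin 1) 0 :=
    ⟨_, fun _ _ => rfl⟩
  have hm0 : ∀ t x, 0 ≤ m t x := fun t x => by rw [hm]; exact le_max_right _ _
  have hclause : ∀ t x, ∃ v w : EuclideanSpace ℝ (Fin 3), ‖v‖ = 1 ∧ ‖w‖ = 1 ∧ inner ℝ v w = 0 ∧
      ∀ α β : ℝ, inner ℝ (fderiv ℝ (u t) x (α • v + β • w)) (α • v + β • w) ≤ m t x * (α ^ 2 + β ^ 2) :=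
    fun t x => (middleStrain_le_iff (fderiv ℝ (u t) x) _).1 (by rw [hm]; exact le_max_left _ _)
  have heq : ∀ t x, ENNReal.ofReal (m t x) = ENNReal.ofReal (strainEigenvalues
      ((fderiv ℝ (u t) x : EuclideanSpace ℝ (Fin 3) →L[ℝ] EuclideanSpace ℝ (Fin 3)) :
        EuclideanSpace ℝ (Fin 3) →ₗ[ℝ] EuclideanSpace ℝ (Fin 3)) finrank_euclideanSpace_fin 1) :=
    fun t x => by rw [hm, ENNReal.ofReal_max, ENNReal.ofReal_zero, max_eq_left zero_le]
  -- a finite subcover of the compact top singular set by germ balls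
  choose! r hr τ hτ0 hτT l hfin using hpt
  obtain ⟨F, hFK, hKF⟩ := (Germ.isCompact_topSingularSet hν hT hcl hLH hdec).elim_nhds_subcover
    (fun x => ball x (r x)) fun x hx => ball_mem_nhds x (hr x hx)
  rcases F.eq_empty_or_nonempty with hF | hF
  · -- no top singular point: empty germ data
    refine ⟨∅, isOpen_empty, fun x hx => by simpa [hF] using hKF hx, 0, hT, 0, m, hm0,
      fun t _ _ x hx _ => (notMem_empty x hx).elim, ?_⟩
    simp [ENNReal.zero_rpow_of_pos he]
  -- `U`: the union of the germ balls; `τ⋆ = F.sup' τ`: the latest germ time; `l⋆ = F.sup' l`: the top level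
  have hτT' : F.sup' hF τ < T := (Finset.sup'_lt_iff hF).2 fun y hy => hτT y (hFK y hy)
  have hτ0' : 0 ≤ F.sup' hF τ := by
    obtain ⟨y₀, hy₀⟩ := id hF
    exact (hτ0 y₀ (hFK y₀ hy₀)).trans (Finset.le_sup' τ hy₀)
  refine ⟨⋃ y ∈ F, ball y (r y), isOpen_biUnion fun _ _ => isOpen_ball, hKF, F.sup' hF τ, hτT',
    F.sup' hF l, m, hm0, fun t _ _ x _ _ => hclause t x, ?_⟩
  -- measurable-in-time versions of the germ slices, valid on `(0,T)`
  choose G hGm hGeq using fun y : EuclideanSpace ℝ (Fin 3) =>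
    exists_measurable_middleStrain_slice hcl (V := ball y (r y)) measurableSet_ball (l y) q
  -- pointwise in time: the fast slice of `U` against the germ slices
  have hslice : ∀ t ∈ Ioo 0 T,
      (∫⁻ x in ({x : EuclideanSpace ℝ (Fin 3) | F.sup' hF l < ‖u t x‖} ∩ ⋃ y ∈ F, ball y (r y)),
          ENNReal.ofReal (m t x) ^ q) ^ (2 / (2 * q - 3)) ≤
        (F.card : ℝ≥0∞) ^ (2 / (2 * q - 3)) * ∑ y ∈ F, G y t ^ (2 / (2 * q - 3)) := by
    intro t ht
    have hsub : ({x : EuclideanSpace ℝ (Fin 3) | F.sup' hF l < ‖u t x‖} ∩ ⋃ y ∈ F, ball y (r y)) ⊆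
        ⋃ y ∈ F, ({x : EuclideanSpace ℝ (Fin 3) | l y < ‖u t x‖} ∩ ball y (r y)) := by
      intro x hx
      obtain ⟨y, hyF, hxy⟩ := mem_iUnion₂.1 hx.2
      exact mem_iUnion₂.2 ⟨y, hyF, (Finset.le_sup' l hyF).trans_lt hx.1, hxy⟩
    calc (∫⁻ x in ({x : EuclideanSpace ℝ (Fin 3) | F.sup' hF l < ‖u t x‖} ∩ ⋃ y ∈ F, ball y (r y)),
          ENNReal.ofReal (m t x) ^ q) ^ (2 / (2 * q - 3))
        ≤ (∫⁻ x in ⋃ y ∈ F, ({x : EuclideanSpace ℝ (Fin 3) | l y < ‖u t x‖} ∩ ball y (r y)),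
            ENNReal.ofReal (strainEigenvalues
              ((fderiv ℝ (u t) x : EuclideanSpace ℝ (Fin 3) →L[ℝ] EuclideanSpace ℝ (Fin 3)) :
                EuclideanSpace ℝ (Fin 3) →ₗ[ℝ] EuclideanSpace ℝ (Fin 3)) finrank_euclideanSpace_fin 1) ^ q) ^
            (2 / (2 * q - 3)) := by
          simp only [heq]
          exact ENNReal.rpow_le_rpow (lintegral_mono_set hsub) he.le
      _ ≤ (F.card : ℝ≥0∞) ^ (2 / (2 * q - 3)) *
            ∑ y ∈ F, (∫⁻ x in {x : EuclideanSpace ℝ (Fin 3) | l y < ‖u t x‖} ∩ ball y (r y),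
              ENNReal.ofReal (strainEigenvalues
                ((fderiv ℝ (u t) x : EuclideanSpace ℝ (Fin 3) →L[ℝ] EuclideanSpace ℝ (Fin 3)) :
                  EuclideanSpace ℝ (Fin 3) →ₗ[ℝ] EuclideanSpace ℝ (Fin 3)) finrank_euclideanSpace_fin 1) ^ q) ^
              (2 / (2 * q - 3)) :=
          rpow_lintegral_biUnion_finset_le volume hF _ _ he.le
      _ = (F.card : ℝ≥0∞) ^ (2 / (2 * q - 3)) * ∑ y ∈ F, G y t ^ (2 / (2 * q - 3)) := by
          congr 1
          refine Finset.sum_congr rfl fun y _ => ?_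
          rw [hGeq y t ht]
  -- integrate in time over `(τ⋆, T) ⊆ (0, T)` and pull the finite sum out of the lower integral
  have hcard : (F.card : ℝ≥0∞) ^ (2 / (2 * q - 3)) ≠ ⊤ :=
    ENNReal.rpow_ne_top_of_nonneg he.le (ENNReal.natCast_ne_top _)
  calc ∫⁻ t in Ioo (F.sup' hF τ) T,
        (∫⁻ x in ({x : EuclideanSpace ℝ (Fin 3) | F.sup' hF l < ‖u t x‖} ∩ ⋃ y ∈ F, ball y (r y)),
          ENNReal.ofReal (m t x) ^ q) ^ (2 / (2 * q - 3))
      ≤ ∫⁻ t in Ioo (F.sup' hF τ) T,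
          (F.card : ℝ≥0∞) ^ (2 / (2 * q - 3)) * ∑ y ∈ F, G y t ^ (2 / (2 * q - 3)) := by
        refine lintegral_mono_ae ?_
        filter_upwards [ae_restrict_mem measurableSet_Ioo] with t ht
        exact hslice t ⟨hτ0'.trans_lt ht.1, ht.2⟩
    _ = (F.card : ℝ≥0∞) ^ (2 / (2 * q - 3)) *
          ∑ y ∈ F, ∫⁻ t in Ioo (F.sup' hF τ) T, G y t ^ (2 / (2 * q - 3)) := by
        rw [lintegral_const_mul' _ _ hcard,
          lintegral_finsetSum F fun y _ => (hGm y).pow_const (2 / (2 * q - 3))]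
    _ < ⊤ := by
        refine ENNReal.mul_lt_top hcard.lt_top (ENNReal.sum_lt_top.2 fun y hy => ?_)
        have hyK : IsBackwardSingularPoint u (T, y) := hFK y hy
        calc ∫⁻ t in Ioo (F.sup' hF τ) T, G y t ^ (2 / (2 * q - 3))
            ≤ ∫⁻ t in Ioo (τ y) T, G y t ^ (2 / (2 * q - 3)) :=
              lintegral_mono_set (Ioo_subset_Ioo_left (Finset.le_sup' τ hy))
          _ = ∫⁻ t in Ioo (τ y) T, (∫⁻ x in {x : EuclideanSpace ℝ (Fin 3) | l y < ‖u t x‖} ∩ ball y (r y),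
                ENNReal.ofReal (strainEigenvalues
                  ((fderiv ℝ (u t) x : EuclideanSpace ℝ (Fin 3) →L[ℝ] EuclideanSpace ℝ (Fin 3)) :
                    EuclideanSpace ℝ (Fin 3) →ₗ[ℝ] EuclideanSpace ℝ (Fin 3)) finrank_euclideanSpace_fin 1) ^ q) ^
                (2 / (2 * q - 3)) :=
              setLIntegral_congr_fun measurableSet_Ioo fun t ht => by
                rw [hGeq y t ⟨(hτ0 y hyK).trans_lt ht.1, ht.2⟩]
          _ < ⊤ := hfin y hyK

end Summit.NavierStokesRegularity.NavierStokesRegularity.Theorems.FastClassSqueeze.GermWeyl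

end
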